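import Mathlib
import HarnessLib
import Summits.HubbardSuperconductivity.HubbardSuperconductivity.Theorems.KLProgrammeMatsubaraSliceBubbleTransfer

/-!
# Route `KLProgramme` — crux K3 split, ENGINE child (`KLRegimeEngineV11` stmt-HubbardSuperconductivity-19823; gen-4 Δ21 (R-w′)): NORM-INSIDE, FINITE-VOLUME
# forms of the slice pair-weight estimates — `Σ_p ‖z_p(Q) − z_p(0)‖` (Q-Lipschitz mass) and `Σ_p ‖z_p‖` (sign-blind mass) on a finite momentum set
# (cell gate-hubbard-kl, seat hubbard-kl-k3c2-p2; asked by p1 g7, STATUS 21:52:53Z «type (2b)-lattice + (2a)-mass»)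

The Δ21 clause `PairLadderStepAtV8` (p1 g7, BundleV12) is met by the engine with the TRUE slice pair weights
`z_p(Q) = β⁻¹ Σ_ν ĝ_n(ν, p)·ĝ_m(−ν, Q − p)` (`p` on the finite torus); its signed-mass conjunct needs `Σ_p ‖z_p(Q) − z_p(0)‖ ≲ v_K|Q|_𝕋/Λ_n · (mass)` and
`Σ_p ‖z_p‖ ≤ bhi`.  These are SIGN-BLIND: pointwise bound × number of kept frequencies below the slice radius × number of momenta in the slice
shell.  This module proves them in GENERIC slice-multiplier form (p1: «generic first, lattice instance second»): momenta range over any finite type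
`P` with an energy map `e₁ : P → ℝ` (the first line, `e_K(p)`), partner values `Ψ i p` (the second line at `(−ω_i, Q − p)`, any scale) and a finite
set `S ⊇ {p : |e₁ p| < r}` (the shell; its cardinal is the level count of k3c2-p1's `card_filter_nambuXiCT_lt_le_of_frameOK`):
* `klzl_norm_freq_sum_le` — one momentum: `‖β⁻¹ • Σ_i Φ(ω_i, e)·Ψ_i‖ ≤ (r/π + 3/β)·A·A'` (`Φ` bounded by `A`, vanishing for `|k₀| ≥ r`);
* `klzl_sum_norm_pair_le` — **`Σ_p ‖β⁻¹ • Σ_i Φ(ω_i, e₁ p)·Ψ i p‖ ≤ #S·(r/π + 3/β)·A·A'`** (momenta off the shell contribute `0`);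
* `klzl_sum_norm_pair_shift_le` — **(2b)** with `Ψ i p = Φ'(−ω_i, e₂ p) − Φ'(−ω_i, e₂⁰ p)`, `Φ'` jointly `K`-Lipschitz (`klsp_lipschitz`),
  `|e₂ p − e₂⁰ p| ≤ D` (`= |e_K(Q−p) − e_K(−p)| ≤ v_K|Q|_𝕋`): `≤ #S·(r/π + 3/β)·A·K·D`;
* `klzl_sum_norm_pair_shift_scale_le` — the SCALE FORM at `n ≤ n_β + 1` with the two slice propagators `(f/s)(ik₀+e)`, `(f'/s)(ik₀+e)` (weights as in
  `klsp_slice_bubble_shift_norm_le`): `≤ #S·(32/π)·M_f·(192ℓ' + 772M_f')·D/Λ_n²` — with `#S ≲ Λ_n·L²` and the `L⁻²` of the momentum average this is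
  `≲ D/Λ_n = v_K|Q|_𝕋/Λ_n` per unit, the (2b) shape; `klzl_sum_norm_pair_scale_le` — the (2a) sign-blind mass `≤ #S·(32/π)·M_f·A'`.
The total-variation identity `Σ_p‖z_p(Q)‖ ≤ Σ_p z_p(0)` (AM–GM) and the lattice instance (TorusSite, FrameOK count) are p1's / the skeleton owner's.
Pure analysis; nothing about the model is asserted.
-/

noncomputable section

namespace Summit.HubbardSuperconductivity.HubbardSuperconductivity.Theorems.KLRegimeSplit

set_option linter.dupNamespace false -- summit = problem name (single-conjunct summit), D-0017

open Real Finset Complex Literature.MathematicalPhysics.QuantumLattice Literature.Probability.LatticeModels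
open Summit.HubbardSuperconductivity.HubbardSuperconductivity.Theorems.KLProgrammeLegKernels

section Generic

variable {P : Type*} [Fintype P] {Φ : ℝ → ℝ → ℂ} {A r : ℝ}

/-- **One momentum**: `Φ` bounded by `A` and vanishing for `|k₀| ≥ r` (`A, A', r ≥ 0`), partner values `‖Ψ_i‖ ≤ A'`, `β > 0`:
`‖β⁻¹ • Σ_i Φ(ω_i, e)·Ψ_i‖ ≤ (r/π + 3/β)·(A·A')`. -/
theorem klzl_norm_freq_sum_le (hA : 0 ≤ A) (hr : 0 ≤ r) (hΦbd : ∀ k₀ e, ‖Φ k₀ e‖ ≤ A)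
    (hΦfst : ∀ k₀, r ≤ |k₀| → ∀ e, Φ k₀ e = 0) {M : ℕ} {Ψ : MatsubaraIdx M → ℂ} {A' : ℝ} (hA' : 0 ≤ A')
    (hΨ : ∀ i, ‖Ψ i‖ ≤ A') (e : ℝ) {β : ℝ} (hβ : 0 < β) :
    ‖β⁻¹ • ∑ i : MatsubaraIdx M, Φ (matsubaraFreq β M i) e * Ψ i‖ ≤ (r / Real.pi + 3 / β) * (A * A') := by
  have hterm : ∀ i : MatsubaraIdx M, ‖Φ (matsubaraFreq β M i) e * Ψ i‖ ≤
      if |matsubaraFreq β M i| < r then A * A' else 0 := by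
    intro i
    split_ifs with hi
    · rw [norm_mul]; exact mul_le_mul (hΦbd _ _) (hΨ i) (norm_nonneg _) hA
    · rw [hΦfst _ (not_lt.mp hi) e, zero_mul, norm_zero]
  have hcard := card_filter_matsubaraFreq_le hβ hr (Finset.univ.filter fun i : MatsubaraIdx M => |matsubaraFreq β M i| < r)
    (fun i hi => ((Finset.mem_filter.mp hi).2).le)
  have hsum : ∑ i : MatsubaraIdx M, (if |matsubaraFreq β M i| < r then A * A' else 0) =
      ((Finset.univ.filter fun i : MatsubaraIdx M => |matsubaraFreq β M i| < r).card : ℝ) * (A * A') := by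
    rw [Finset.sum_ite, Finset.sum_const_zero, add_zero, Finset.sum_const, nsmul_eq_mul]
  calc ‖β⁻¹ • ∑ i : MatsubaraIdx M, Φ (matsubaraFreq β M i) e * Ψ i‖
      = β⁻¹ * ‖∑ i : MatsubaraIdx M, Φ (matsubaraFreq β M i) e * Ψ i‖ := by
        rw [norm_smul, norm_inv, Real.norm_of_nonneg hβ.le]
    _ ≤ β⁻¹ * ∑ i : MatsubaraIdx M, (if |matsubaraFreq β M i| < r then A * A' else 0) :=
        mul_le_mul_of_nonneg_left ((norm_sum_le _ _).trans (Finset.sum_le_sum fun i _ => hterm i)) (inv_nonneg.mpr hβ.le)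
    _ ≤ β⁻¹ * ((r * β / Real.pi + 3) * (A * A')) := by
        rw [hsum]; exact mul_le_mul_of_nonneg_left (mul_le_mul_of_nonneg_right hcard (by positivity)) (inv_nonneg.mpr hβ.le)
    _ = (r / Real.pi + 3 / β) * (A * A') := by field_simp

/-- **The norm-inside momentum sum (sign-blind mass).**  `P` a finite momentum set, `e₁ : P → ℝ` the first line's energy, `S ⊇ {p : |e₁ p| < r}`
the shell; `Φ` bounded by `A`, vanishing for `|k₀| ≥ r` and for `|e| ≥ r`; partners `‖Ψ i p‖ ≤ A'`; `β > 0`: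
`Σ_p ‖β⁻¹ • Σ_i Φ(ω_i, e₁ p)·Ψ i p‖ ≤ #S·((r/π + 3/β)·(A·A'))`. -/
theorem klzl_sum_norm_pair_le (hA : 0 ≤ A) (hr : 0 ≤ r) (hΦbd : ∀ k₀ e, ‖Φ k₀ e‖ ≤ A)
    (hΦfst : ∀ k₀, r ≤ |k₀| → ∀ e, Φ k₀ e = 0) (hΦsnd : ∀ k₀ e, r ≤ |e| → Φ k₀ e = 0)
    (e₁ : P → ℝ) (S : Finset P) (hS : ∀ p, |e₁ p| < r → p ∈ S)
    {M : ℕ} {Ψ : MatsubaraIdx M → P → ℂ} {A' : ℝ} (hA' : 0 ≤ A') (hΨ : ∀ i p, ‖Ψ i p‖ ≤ A') {β : ℝ} (hβ : 0 < β) :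
    ∑ p, ‖β⁻¹ • ∑ i : MatsubaraIdx M, Φ (matsubaraFreq β M i) (e₁ p) * Ψ i p‖ ≤
      (S.card : ℝ) * ((r / Real.pi + 3 / β) * (A * A')) := by
  classical
  have hc : 0 ≤ (r / Real.pi + 3 / β) * (A * A') := by positivity
  have hp : ∀ p, ‖β⁻¹ • ∑ i : MatsubaraIdx M, Φ (matsubaraFreq β M i) (e₁ p) * Ψ i p‖ ≤
      if p ∈ S then (r / Real.pi + 3 / β) * (A * A') else 0 := by
    intro p
    split_ifs with hpS
    · exact klzl_norm_freq_sum_le hA hr hΦbd hΦfst hA' (fun i => hΨ i p) (e₁ p) hβ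
    · have he : r ≤ |e₁ p| := not_lt.mp fun h => hpS (hS p h)
      simp_rw [hΦsnd _ (e₁ p) he, zero_mul]
      rw [Finset.sum_const_zero, smul_zero, norm_zero]
  refine (Finset.sum_le_sum fun p _ => hp p).trans (le_of_eq ?_)
  rw [Finset.sum_ite_mem, Finset.univ_inter, Finset.sum_const, nsmul_eq_mul]

/-- **(2b) The Q-Lipschitz mass, generic form.**  As above, with the partner a DIFFERENCE of a jointly `K`-Lipschitz second propagator `Φ'` at two
energies `e₂ p`, `e₂⁰ p` with `|e₂ p − e₂⁰ p| ≤ D` (frequency `−ω_i` in both):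
`Σ_p ‖β⁻¹ • Σ_i Φ(ω_i, e₁ p)·(Φ'(−ω_i, e₂ p) − Φ'(−ω_i, e₂⁰ p))‖ ≤ #S·((r/π + 3/β)·(A·(K·D)))`. -/
theorem klzl_sum_norm_pair_shift_le (hA : 0 ≤ A) (hr : 0 ≤ r) (hΦbd : ∀ k₀ e, ‖Φ k₀ e‖ ≤ A)
    (hΦfst : ∀ k₀, r ≤ |k₀| → ∀ e, Φ k₀ e = 0) (hΦsnd : ∀ k₀ e, r ≤ |e| → Φ k₀ e = 0)
    (e₁ : P → ℝ) (S : Finset P) (hS : ∀ p, |e₁ p| < r → p ∈ S)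
    {Φ' : ℝ → ℝ → ℂ} {K : ℝ} (hK : 0 ≤ K) (hΦ'lip : ∀ k₀ e k₀' e', ‖Φ' k₀ e - Φ' k₀' e'‖ ≤ K * (|k₀ - k₀'| + |e - e'|))
    (e₂ e₂₀ : P → ℝ) {D : ℝ} (hD0 : 0 ≤ D) (hD : ∀ p, |e₂ p - e₂₀ p| ≤ D) {M : ℕ} {β : ℝ} (hβ : 0 < β) :
    ∑ p, ‖β⁻¹ • ∑ i : MatsubaraIdx M, Φ (matsubaraFreq β M i) (e₁ p) *
        (Φ' (-matsubaraFreq β M i) (e₂ p) - Φ' (-matsubaraFreq β M i) (e₂₀ p))‖ ≤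
      (S.card : ℝ) * ((r / Real.pi + 3 / β) * (A * (K * D))) := by
  refine klzl_sum_norm_pair_le hA hr hΦbd hΦfst hΦsnd e₁ S hS (Ψ := fun i p =>
    Φ' (-matsubaraFreq β M i) (e₂ p) - Φ' (-matsubaraFreq β M i) (e₂₀ p)) (by positivity) (fun i p => ?_) hβ
  refine (hΦ'lip _ _ _ _).trans ?_
  rw [sub_self, abs_zero, zero_add]
  exact mul_le_mul_of_nonneg_left (hD p) hK

end Generic

/-! ## Scale forms with the slice propagators -/

section ScaleForm

variable {P : Type*} [Fintype P] {f f' : ℝ → ℂ} {Mf Lf' Mf' ℓ' : ℝ}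

/-- The frequency-count factor with the SHARP propagator sup: `(4Λ/π + 3/β)·(2M_f/Λ) ≤ (32/π)·M_f` for `n ≤ n_β + 1`. -/
theorem klzl_count_mul_sup_le {n : ℕ} (hMf : 0 ≤ Mf) {β : ℝ} (hβ : klBetaMin ≤ β) (hn : n ≤ nScales β + 1) :
    (4 * klScale klE0 n / Real.pi + 3 / β) * (Mf / (klScale klE0 n / 2)) ≤ 32 / Real.pi * Mf := by
  have hΛ := klth_klScale_pos n
  have h := klsp_count_factor_le hβ hn
  calc (4 * klScale klE0 n / Real.pi + 3 / β) * (Mf / (klScale klE0 n / 2))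
      ≤ (16 / Real.pi * klScale klE0 n) * (Mf / (klScale klE0 n / 2)) := mul_le_mul_of_nonneg_right h (by positivity)
    _ = 32 / Real.pi * Mf := by field_simp; ring

/-- **(2a) sign-blind mass, scale form.**  First line = slice-`n` propagator `(f(s)/s)(ik₀+e)` (`‖f‖ ≤ M_f`, `f = 0` for `s ≤ (Λ_n/2)²` and
`s ≥ (4Λ_n)²`), shell `S ⊇ {p : |e₁ p| < 4Λ_n}`, partners `‖Ψ i p‖ ≤ A'`, `n ≤ n_β + 1`:
`Σ_p ‖β⁻¹ • Σ_i Φ(ω_i, e₁ p)·Ψ i p‖ ≤ #S·(32/π)·M_f·A'`. -/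
theorem klzl_sum_norm_pair_scale_le (hbd : ∀ s, ‖f s‖ ≤ Mf) {n : ℕ}
    (hin : ∀ s, s ≤ (klScale klE0 n / 2) ^ 2 → f s = 0) (hout : ∀ s, (4 * klScale klE0 n) ^ 2 ≤ s → f s = 0)
    (e₁ : P → ℝ) (S : Finset P) (hS : ∀ p, |e₁ p| < 4 * klScale klE0 n → p ∈ S)
    {M : ℕ} {Ψ : MatsubaraIdx M → P → ℂ} {A' : ℝ} (hA' : 0 ≤ A') (hΨ : ∀ i p, ‖Ψ i p‖ ≤ A')
    {β : ℝ} (hβ : klBetaMin ≤ β) (hn : n ≤ nScales β + 1) :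
    ∑ p, ‖β⁻¹ • ∑ i : MatsubaraIdx M,
        (f (matsubaraFreq β M i ^ 2 + e₁ p ^ 2) / (((matsubaraFreq β M i ^ 2 + e₁ p ^ 2 : ℝ)) : ℂ) *
          (I * (matsubaraFreq β M i) + (e₁ p : ℝ))) * Ψ i p‖ ≤
      (S.card : ℝ) * (32 / Real.pi * Mf * A') := by
  have hΛ := klth_klScale_pos n
  have hβ0 : 0 < β := pos_of_klBetaMin_le hβ
  have hMf : 0 ≤ Mf := (norm_nonneg _).trans (hbd 0)
  have hr₁ : 0 < klScale klE0 n / 2 := by positivity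
  have hr : 0 < 4 * klScale klE0 n := by positivity
  have hgsupp : ∀ s, (4 * klScale klE0 n) ^ 2 ≤ s → (fun s : ℝ => f s / ((s : ℝ) : ℂ)) s = 0 := fun s hs => by
    simp only [hout s hs, zero_div]
  have h := klzl_sum_norm_pair_le (P := P)
    (Φ := fun k₀ e => f (k₀ ^ 2 + e ^ 2) / (((k₀ ^ 2 + e ^ 2 : ℝ)) : ℂ) * (I * k₀ + e))
    (A := Mf / (klScale klE0 n / 2)) (by positivity) hr.le
    (fun k₀ e => klsp_div_propagator_norm_le hbd hin hr₁ k₀ e)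
    (fun k₀ hk e => klsp_zero_of_le_abs_fst hgsupp hr.le hk e)
    (fun k₀ e he => klsp_zero_of_le_abs_snd hgsupp hr.le k₀ he)
    e₁ S hS hA' hΨ hβ0
  refine h.trans (mul_le_mul_of_nonneg_left ?_ (Nat.cast_nonneg _))
  have := klzl_count_mul_sup_le hMf hβ hn
  calc (4 * klScale klE0 n / Real.pi + 3 / β) * (Mf / (klScale klE0 n / 2) * A')
      = (4 * klScale klE0 n / Real.pi + 3 / β) * (Mf / (klScale klE0 n / 2)) * A' := by ring
    _ ≤ 32 / Real.pi * Mf * A' := mul_le_mul_of_nonneg_right this hA'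

/-- **(2b) Q-Lipschitz mass, scale form.**  First line as above; second line = slice propagator `(f'(s)/s)(ik₀+e)` (`‖f'‖ ≤ M_f'`, `L_f'`-Lipschitz,
`L_f' ≤ ℓ'/Λ_n²`, `f' = 0` for `s ≤ (Λ_n/2)²` and `s ≥ (4Λ_n)²`) read at energies `e₂ p` and `e₂⁰ p` with `|e₂ p − e₂⁰ p| ≤ D`, frequency `−ω_i`:
`Σ_p ‖β⁻¹ • Σ_i Φ(ω_i, e₁ p)·(Ψ(−ω_i, e₂ p) − Ψ(−ω_i, e₂⁰ p))‖ ≤ #S·(32/π)·M_f·(192ℓ' + 772M_f')·D/Λ_n²`. -/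
theorem klzl_sum_norm_pair_shift_scale_le (hbd : ∀ s, ‖f s‖ ≤ Mf) {n : ℕ}
    (hin : ∀ s, s ≤ (klScale klE0 n / 2) ^ 2 → f s = 0) (hout : ∀ s, (4 * klScale klE0 n) ^ 2 ≤ s → f s = 0)
    (hlip' : ∀ s s', ‖f' s - f' s'‖ ≤ Lf' * |s - s'|) (hbd' : ∀ s, ‖f' s‖ ≤ Mf') (hLf' : Lf' ≤ ℓ' / klScale klE0 n ^ 2)
    (hin' : ∀ s, s ≤ (klScale klE0 n / 2) ^ 2 → f' s = 0) (hout' : ∀ s, (4 * klScale klE0 n) ^ 2 ≤ s → f' s = 0)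
    (e₁ e₂ e₂₀ : P → ℝ) (S : Finset P) (hS : ∀ p, |e₁ p| < 4 * klScale klE0 n → p ∈ S)
    {D : ℝ} (hD0 : 0 ≤ D) (hD : ∀ p, |e₂ p - e₂₀ p| ≤ D)
    {M : ℕ} {β : ℝ} (hβ : klBetaMin ≤ β) (hn : n ≤ nScales β + 1) :
    ∑ p, ‖β⁻¹ • ∑ i : MatsubaraIdx M,
        (f (matsubaraFreq β M i ^ 2 + e₁ p ^ 2) / (((matsubaraFreq β M i ^ 2 + e₁ p ^ 2 : ℝ)) : ℂ) *
          (I * (matsubaraFreq β M i) + (e₁ p : ℝ))) *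
        ((f' ((-matsubaraFreq β M i) ^ 2 + e₂ p ^ 2) / ((((-matsubaraFreq β M i) ^ 2 + e₂ p ^ 2 : ℝ)) : ℂ) *
            (I * ((-matsubaraFreq β M i : ℝ) : ℂ) + (e₂ p : ℝ))) -
          (f' ((-matsubaraFreq β M i) ^ 2 + e₂₀ p ^ 2) / ((((-matsubaraFreq β M i) ^ 2 + e₂₀ p ^ 2 : ℝ)) : ℂ) *
            (I * ((-matsubaraFreq β M i : ℝ) : ℂ) + (e₂₀ p : ℝ))))‖ ≤
      (S.card : ℝ) * (32 / Real.pi * Mf * (192 * ℓ' + 772 * Mf') * D / klScale klE0 n ^ 2) := by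
  set Λ := klScale klE0 n with hΛdef
  have hΛ : 0 < Λ := klth_klScale_pos n
  have hβ0 : 0 < β := pos_of_klBetaMin_le hβ
  have hMf : 0 ≤ Mf := (norm_nonneg _).trans (hbd 0)
  have hMf' : 0 ≤ Mf' := (norm_nonneg _).trans (hbd' 0)
  have hr₁ : 0 < Λ / 2 := by positivity
  have hr : 0 < 4 * Λ := by positivity
  have hLf'0 : 0 ≤ Lf' := by
    have := hlip' 0 1; have h0 : (0:ℝ) ≤ ‖f' 0 - f' 1‖ := norm_nonneg _; norm_num at this; linarith
  have hℓ' : 0 ≤ ℓ' := by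
    have : 0 ≤ ℓ' / Λ ^ 2 := hLf'0.trans hLf'
    rwa [le_div_iff₀ (by positivity), zero_mul] at this
  have hgsupp : ∀ s, (4 * Λ) ^ 2 ≤ s → (fun s : ℝ => f s / ((s : ℝ) : ℂ)) s = 0 := fun s hs => by
    simp only [hout s hs, zero_div]
  have hg'supp : ∀ s, (4 * Λ) ^ 2 ≤ s → (fun s : ℝ => f' s / ((s : ℝ) : ℂ)) s = 0 := fun s hs => by
    simp only [hout' s hs, zero_div]
  have hg'lip : ∀ s s', ‖(fun s : ℝ => f' s / ((s : ℝ) : ℂ)) s - (fun s : ℝ => f' s / ((s : ℝ) : ℂ)) s'‖ ≤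
      (Lf' / (Λ / 2) ^ 2 + Mf' / (Λ / 2) ^ 4) * |s - s'| := fun s s' => klsp_div_lipschitz hlip' hbd' hin' hr₁ s s'
  have hg'bd : ∀ s, ‖(fun s : ℝ => f' s / ((s : ℝ) : ℂ)) s‖ ≤ Mf' / (Λ / 2) ^ 2 := fun s => klsp_div_norm_le hbd' hin' hr₁ s
  set K : ℝ := 3 * (Lf' / (Λ / 2) ^ 2 + Mf' / (Λ / 2) ^ 4) * (4 * Λ) ^ 2 + Mf' / (Λ / 2) ^ 2 with hK
  have hK0 : 0 ≤ K := by positivity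
  have h := klzl_sum_norm_pair_shift_le (P := P)
    (Φ := fun k₀ e => f (k₀ ^ 2 + e ^ 2) / (((k₀ ^ 2 + e ^ 2 : ℝ)) : ℂ) * (I * k₀ + e))
    (A := Mf / (Λ / 2)) (by positivity) hr.le
    (fun k₀ e => klsp_div_propagator_norm_le hbd hin hr₁ k₀ e)
    (fun k₀ hk e => klsp_zero_of_le_abs_fst hgsupp hr.le hk e)
    (fun k₀ e he => klsp_zero_of_le_abs_snd hgsupp hr.le k₀ he)
    e₁ S hS
    (Φ' := fun k₀ e => f' (k₀ ^ 2 + e ^ 2) / (((k₀ ^ 2 + e ^ 2 : ℝ)) : ℂ) * (I * k₀ + e)) hK0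
    (fun k₀ e k₀' e' => klsp_lipschitz hg'lip hg'bd hg'supp hr k₀ e k₀' e')
    e₂ e₂₀ hD0 hD (M := M) hβ0
  refine (le_of_eq ?_).trans (h.trans (mul_le_mul_of_nonneg_left ?_ (Nat.cast_nonneg _)))
  · -- the two sides are the same sum (casts of `-ω`)
    refine Finset.sum_congr rfl fun p _ => ?_
    push_cast
    rfl
  -- constants: `(4Λ/π + 3/β)(2M_f/Λ) ≤ (32/π)M_f` and `K ≤ (192ℓ' + 772M_f')/Λ²`
  have hcs := klzl_count_mul_sup_le hMf hβ hn
  rw [← hΛdef] at hcs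
  have hKle : K ≤ (192 * ℓ' + 772 * Mf') / Λ ^ 2 := by
    have hKeq : K = 192 * Lf' + 772 * Mf' / Λ ^ 2 := by
      rw [hK]; field_simp; ring
    rw [hKeq, add_div]
    have : 192 * Lf' ≤ 192 * ℓ' / Λ ^ 2 := by rw [mul_div_assoc]; exact mul_le_mul_of_nonneg_left hLf' (by norm_num)
    linarith
  calc (4 * Λ / Real.pi + 3 / β) * (Mf / (Λ / 2) * (K * D))
      = ((4 * Λ / Real.pi + 3 / β) * (Mf / (Λ / 2))) * (K * D) := by ring
    _ ≤ (32 / Real.pi * Mf) * ((192 * ℓ' + 772 * Mf') / Λ ^ 2 * D) :=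
        mul_le_mul hcs (mul_le_mul_of_nonneg_right hKle hD0) (by positivity) (by positivity)
    _ = 32 / Real.pi * Mf * (192 * ℓ' + 772 * Mf') * D / Λ ^ 2 := by field_simp

end ScaleForm

end Summit.HubbardSuperconductivity.HubbardSuperconductivity.Theorems.KLRegimeSplit

end
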